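import Summits.Ventures.PercRepro.S2ThirteenSevenSpreadLeFour
import Summits.Ventures.PercRepro.S2ThirteenSevenSpreadEight
import Summits.Ventures.PercRepro.S2ThirteenSevenSpreadNine
import Summits.Ventures.PercRepro.S1FiveCircuitsSolidSixSharp

/-!
# PercRepro — S2: THE SPREAD CASE OF THE CELL `(13, 7)` MODULO THE SPREAD CAP `s₅ ≤ 146`, AND MODULO p1's PLANE-POOR
`8`-SPREAD TABLE (p7, gen 17; sub-claim S2)

**`c025_thirteen_seven_cf_spread_of_cap`**: on every coloop-free spread `e`-free core of rank `13` on `20` points with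
`s₅ ≤ 146`, `RLS M 13 5` — the rows `t ≤ 4` (`c025_thirteen_seven_cf_spread_le_four`, unconditional), `4 ≤ t ≤ 8`
(`c025_thirteen_seven_cf_spread_le_eight_of_caps`) and `t ≥ 9` (`c025_thirteen_seven_cf_spread_ge_nine_of_caps`), the cap
`s₄ ≤ 41` discharged by p1 g33's nullity-`7` spread chain (`S1.ncard_fourCircuits_le_forty_one_spread_twenty`).
**`c025_thirteen_seven_cf_spread_of_table`**: the same with `s₅ ≤ 146` discharged by p1 g33's
`S1.ncard_fiveCircuits_le_one_forty_six_thirteen_seven_of_tPoorSix`, MODULO THE PLANE-POOR `8`-SPREAD TABLE AT NULLITIES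
`3 … 6` (the hypothesis `ht`, stated verbatim as p1 states it): a CONDITIONAL theorem — the spread case of the coloop-free cell
`(13, 7)` is a tree theorem modulo that table. The concentrated cases and the coloop sub-cells of `(13, 7)` stay OPEN; nothing
about the cell is claimed. Axioms: standard.
-/

open scoped Matroid

namespace PercRepro

namespace ThmN

open Set

variable {α : Type}

/-- **The spread case of the coloop-free cell `(13, 7)` modulo the spread cap `s₅ ≤ 146`** (`s₄ ≤ 41` is in the tree). -/
theorem c025_thirteen_seven_cf_spread_of_cap (M : Matroid α) [M.Finite]
    (hR : M.eRank = ((13 : ℕ) : ℕ∞)) (hn : M.E.ncard = 13 + 7)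
    (hfree : ∀ e ∈ M.E, ∃ A ⊆ M.E \ {e}, e ∉ M.closure A ∧ e ∉ M.closure ((M.E \ {e}) \ A)) (hK : ∀ e, ¬ M.IsColoop e)
    (h4 : ¬ ∃ W ⊆ M.E, W.ncard ≤ 9 ∧ W.encard = M.eRk W + 4)
    (hs5c : {C : Set α | M.IsCircuit C ∧ C.ncard = 5}.ncard ≤ 146) : RLS M 13 5 := by
  have hd : M.E.encard = M.eRank + 7 := by
    rw [hR, ← M.ground_finite.cast_ncard_eq, hn]
    push_cast
    ring
  have hs4c := S1.ncard_fourCircuits_le_forty_one_spread_twenty M hfree h4 hd hn hK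
  by_cases ht4 : {C : Set α | M.IsCircuit C ∧ C.ncard = 3}.ncard ≤ 4
  · exact c025_thirteen_seven_cf_spread_le_four M hR hn hfree hK h4 ht4
  by_cases ht8 : {C : Set α | M.IsCircuit C ∧ C.ncard = 3}.ncard ≤ 8
  · exact c025_thirteen_seven_cf_spread_le_eight_of_caps M hR hn hfree h4 hs4c hs5c (by omega) ht8
  · exact c025_thirteen_seven_cf_spread_ge_nine_of_caps M hR hn hfree hK h4 hs4c hs5c (by omega)

/-- **The spread case of the coloop-free cell `(13, 7)` modulo p1's plane-poor `8`-spread table at nullities `3 … 6`**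
(the hypothesis `ht` of `S1.ncard_fiveCircuits_le_one_forty_six_thirteen_seven_of_tPoorSix`, verbatim): CONDITIONAL. -/
theorem c025_thirteen_seven_cf_spread_of_table
    (ht : ∀ (N' : Matroid α) [N'.Finite], S1.PlanePoor N' → S1.Spread8 N' → ∀ j : ℕ, 3 ≤ j → j ≤ 6 →
      N'.E.encard = N'.eRank + j → ∀ f ∈ N'.E,
      {D : Set α | N'.IsCircuit D ∧ D.ncard = 4 ∧ f ∈ D}.ncard ≤ S1.tPoorSix j)
    (M : Matroid α) [M.Finite]
    (hR : M.eRank = ((13 : ℕ) : ℕ∞)) (hn : M.E.ncard = 13 + 7)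
    (hfree : ∀ e ∈ M.E, ∃ A ⊆ M.E \ {e}, e ∉ M.closure A ∧ e ∉ M.closure ((M.E \ {e}) \ A)) (hK : ∀ e, ¬ M.IsColoop e)
    (h4 : ¬ ∃ W ⊆ M.E, W.ncard ≤ 9 ∧ W.encard = M.eRk W + 4) : RLS M 13 5 := by
  have hd : M.E.encard = M.eRank + 7 := by
    rw [hR, ← M.ground_finite.cast_ncard_eq, hn]
    push_cast
    ring
  exact c025_thirteen_seven_cf_spread_of_cap M hR hn hfree hK h4
    (S1.ncard_fiveCircuits_le_one_forty_six_thirteen_seven_of_tPoorSix M hfree h4 hd hn hK ht)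

end ThmN

end PercRepro
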